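import Literature.Probability.RandomPlanarGeometry.SAWBridgeRatioRate
import Literature.Probability.RandomPlanarGeometry.SAWHalfSpaceConcat
import Literature.Probability.Process.RenewalRatioSandwich
import Mathlib.Analysis.SpecialFunctions.Pow.Real
import Mathlib.Analysis.SpecialFunctions.Pow.Asymptotics
import HarnessLib

/-!
# The one-step ratio rate `|w_{N+1}/w_N − μ| ≤ K/log N` for ANY count sequence dominating Kesten's renewal

Topic `Literature/Probability/RandomPlanarGeometry` (continues `SAWBridgeRatioRate.lean`; generic engine).

Sources: N. Madras, G. Slade, *The Self-Avoiding Walk* (1993), Theorem 7.3.4 (d) and its proof via (7.3.14)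
(book pp. 248–249; held text `book:madras1993-self-avoiding-walk` p0261:L12–p0262:L18) — for bridges, a limit
with no rate; G. Lawler, O. Schramm, W. Werner, *On the scaling limit of planar self-avoiding walk* (2004),
Appendix, (A.3) `h_{n+1}/h_n → μ` for HALF-SPACE walks via the renewal inequality `h_n ≥ Σ_j λ_j h_{n−j}` and a
lim sup argument (arXiv:math/0204277 p. 18) — again no rate [LawlerSchrammWerner2004SAW].

## What is new in this file (not in print)

The bridge argument of `SAWBridgeRatioRate.lean` uses the renewal equation only through the INEQUALITY
`Σ_{1≤k≤n} λ_k w_{n−k} ≤ w_n`; here it is run for an arbitrary positive sequence `w` on `ℤ^{d+2}` satisfying that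
inequality and an upper two-step rate `w_{N+2}/w_N ≤ μ²(1 + K N^{-1/4})` (`N ≥ N₀`):
* `ratio_rate_log_of` — `∃ K, ∀ N ≥ 2, |w_{N+1}/w_N − μ| ≤ K/log N`;
* `ratio_rate_eventually_of` — the constant read off, `μ(128μ + 64μK + 64K)`;
* `ratio_rate_limsup_of` — the sharp-constant form `(2μ/(αE) + δ)/log N` eventually, `E` any odd partial sum of
  Kesten's masses.
Instances: bridges (`SAWBridgeRatioRate.lean`), half-space walks (`w = h`: LSW's renewal inequality is the tree's
`sum_irreducibleBridgeCount_mul_halfSpaceCount_le`, so only a two-step rate for `h` remains as input; lane «pcv-sawmu»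
route R27), and any future count class with these two inputs.
-/

noncomputable section

open Finset Filter Topology Literature.Probability.LatticeModels
open scoped BigOperators

namespace Literature.Probability.RandomPlanarGeometry.SAW.Zd

/-- The normalised sequence `a_n = w_n μ^{-n}` on `ℤ^{d+2}`. [cite: MadrasSlade1993, §4.2, eq. (4.2.5) (p. 91)] -/
def normCount (d : ℕ) (w : ℕ → ℝ) (n : ℕ) : ℝ := w n / connectiveConstant (d + 2) ^ n

/-- `a_n > 0` for a positive sequence. [cite: MadrasSlade1993, §4.2 (p. 91)] -/
theorem normCount_pos (d : ℕ) {w : ℕ → ℝ} (hw : ∀ n, 0 < w n) (n : ℕ) : 0 < normCount d w n := by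
  have hμ := connectiveConstant_pos (d + 2)
  have := hw n
  unfold normCount; positivity

/-- The renewal INEQUALITY in normalised form: `Σ_{1≤k≤n} p_k a_{n−k} ≤ a_n` from `Σ_{1≤k≤n} λ_k w_{n−k} ≤ w_n`.
[cite: MadrasSlade1993, §4.2, eq. (4.2.2)/(4.2.5) (p. 91); LawlerSchrammWerner2004SAW, Appendix (A.3)] -/
theorem normCount_renewal_le (d : ℕ) {w : ℕ → ℝ}
    (hren : ∀ n, 1 ≤ n → ∑ k ∈ Icc 1 n, (irreducibleBridgeCount (d + 2) k : ℝ) * w (n - k) ≤ w n) :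
    ∀ n, 1 ≤ n → ∑ k ∈ Icc 1 n, renewalP (d + 2) k * normCount d w (n - k) ≤ normCount d w n := by
  intro n hn
  have hμ := connectiveConstant_pos (d + 2)
  have h := hren n hn
  unfold renewalP normCount
  have e : ∑ k ∈ Icc 1 n, (irreducibleBridgeCount (d + 2) k : ℝ) / connectiveConstant (d + 2) ^ k *
      (w (n - k) / connectiveConstant (d + 2) ^ (n - k)) =
      (∑ k ∈ Icc 1 n, (irreducibleBridgeCount (d + 2) k : ℝ) * w (n - k)) / connectiveConstant (d + 2) ^ n := by
    rw [Finset.sum_div]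
    refine Finset.sum_congr rfl fun k hk => ?_
    have hkn : k ≤ n := (Finset.mem_Icc.1 hk).2
    rw [div_mul_div_comm, ← pow_add, Nat.add_sub_cancel' hkn]
  rw [e]
  exact div_le_div_of_nonneg_right h (pow_pos hμ n).le

/-- The packaged factor-4 sandwich under a renewal inequality (from `Renewal.ratio_sandwich_sharp_of_le`). [folklore] -/
private theorem sandwich_packaged_of_le (a p : ℕ → ℝ) (N T : ℕ) (η : ℝ) (hT1 : 1 ≤ T) (hT : 2 * T + 1 ≤ N)
    (hη : 0 ≤ η) (hTη : (T : ℝ) * η ≤ 1 / 2)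
    (ha0 : ∀ n, 0 ≤ a n) (hp0 : ∀ k, 0 ≤ p k) (haN : 0 < a N) (haN1 : 0 < a (N - 1)) (hp1 : 0 < p 1)
    (hsum : ∑ k ∈ Icc 1 (2 * T + 1), p k ≤ 1)
    (hren_le : ∀ n, 1 ≤ n → ∑ k ∈ Icc 1 n, p k * a (n - k) ≤ a n)
    (hup : ∀ M, N - (2 * T + 1) ≤ M → M + 2 ≤ N → a (M + 2) ≤ (1 + η) * a M) :
    |a N / a (N - 1) - 1| ≤
      4 * (((1 - ∑ k ∈ Icc 1 (2 * T), p k) + T * η) / (∑ t ∈ range T, p (2 * t + 1)) + T * η) := by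
  have h := _root_.Literature.Probability.Process.Renewal.ratio_sandwich_sharp_of_le a p N T η hT1 hT hη hTη
    ha0 hp0 haN haN1 hp1 hsum hren_le hup
  set ε := 1 - ∑ k ∈ Icc 1 (2 * T), p k with hε
  set Eo := ∑ t ∈ range T, p (2 * t + 1) with hEo
  have hEo_pos : 0 < Eo := by
    have : p (2 * 0 + 1) ≤ Eo :=
      Finset.single_le_sum (f := fun t => p (2 * t + 1)) (fun t _ => hp0 _)
        (Finset.mem_range.2 (by omega))
    simp only [Nat.mul_zero, Nat.zero_add] at this
    linarith
  have hTη0 : 0 ≤ (T : ℝ) * η := mul_nonneg (Nat.cast_nonneg T) hη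
  have hε0 : 0 ≤ ε := by
    have h1 := hsum
    rw [Finset.sum_Icc_succ_top (by omega)] at h1
    have := hp0 (2 * T + 1)
    rw [hε]; linarith
  have hθ : (1 : ℝ) / 2 ≤ 1 - T * η := by linarith
  have h2 : (ε + T * η) / ((1 - T * η) * Eo) ≤ 2 * ((ε + T * η) / Eo) := by
    rw [div_le_iff₀ (mul_pos (by linarith) hEo_pos)]
    have e : 2 * ((ε + T * η) / Eo) * ((1 - T * η) * Eo) = 2 * (ε + T * η) * (1 - T * η) := by
      field_simp
    rw [e]; nlinarith
  have hb0 : 0 ≤ (ε + T * η) / Eo := div_nonneg (by linarith) hEo_pos.le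
  exact h.trans (by linarith)

/-- The window control from the upper two-step rate: with `η = 2K n^{-1/4}`, for every `M`
in `[n − 2T − 1, n − 2]` (where `M ≥ n/2 ≥ N₀`), `a_{M+2} ≤ (1+η) a_M`.
[cite: MadrasSlade1993, Theorem 7.3.4 (d) (proof), eq. (7.3.13)] -/
theorem hup_of_upperRate (d : ℕ) {w : ℕ → ℝ} (hw : ∀ n, 0 < w n) {K : ℝ} {N₀ : ℕ} (hK : 0 ≤ K) (hU : ∀ N : ℕ, N₀ ≤ N → w (N + 2) / w N ≤ connectiveConstant (d + 2) ^ 2 * (1 + K * (N : ℝ) ^ (-(1 : ℝ) / 4)))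
    {n T : ℕ} (hwin : 2 * (2 * T + 1) ≤ n) (hN₀ : 2 * N₀ ≤ n) :
    ∀ M, n - (2 * T + 1) ≤ M → M + 2 ≤ n →
      normCount d w (M + 2) ≤ (1 + 2 * K * (n : ℝ) ^ (-(1 : ℝ) / 4)) * normCount d w M := by
  intro M hM1 hM2
  have h2M : n ≤ 2 * M := by omega
  have hMN : N₀ ≤ M := by omega
  have hM0 : 1 ≤ M := by omega
  set μ := connectiveConstant (d + 2) with hμdef
  have hμ : 0 < μ := connectiveConstant_pos (d + 2)
  have hbM : (0 : ℝ) < w M := hw M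
  -- `M^{-1/4} ≤ 2 n^{-1/4}`
  have hn0 : (0 : ℝ) < n := by exact_mod_cast (show 0 < n by omega)
  have hMr : (n : ℝ) / 2 ≤ M := by
    have : (n : ℝ) ≤ 2 * M := by exact_mod_cast h2M
    linarith
  have hpow : (M : ℝ) ^ (-(1 : ℝ) / 4) ≤ 2 * (n : ℝ) ^ (-(1 : ℝ) / 4) := by
    have h1 : (M : ℝ) ^ (-(1 : ℝ) / 4) ≤ ((n : ℝ) / 2) ^ (-(1 : ℝ) / 4) :=
      Real.rpow_le_rpow_of_nonpos (by positivity) hMr (by norm_num)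
    have h2 : ((n : ℝ) / 2) ^ (-(1 : ℝ) / 4) = (n : ℝ) ^ (-(1 : ℝ) / 4) / (2 : ℝ) ^ (-(1 : ℝ) / 4) :=
      Real.div_rpow hn0.le (by norm_num) _
    have h3 : (1 / 2 : ℝ) ≤ (2 : ℝ) ^ (-(1 : ℝ) / 4) := by
      rw [show (-(1 : ℝ) / 4) = -((1 : ℝ) / 4) by ring, Real.rpow_neg (by norm_num), one_div]
      refine inv_anti₀ (by positivity) ?_
      calc (2 : ℝ) ^ ((1 : ℝ) / 4) ≤ (2 : ℝ) ^ (1 : ℝ) :=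
            Real.rpow_le_rpow_of_exponent_le (by norm_num) (by norm_num)
        _ = 2 := Real.rpow_one 2
    have h4 : 0 ≤ (n : ℝ) ^ (-(1 : ℝ) / 4) := Real.rpow_nonneg hn0.le _
    calc (M : ℝ) ^ (-(1 : ℝ) / 4) ≤ (n : ℝ) ^ (-(1 : ℝ) / 4) / (2 : ℝ) ^ (-(1 : ℝ) / 4) := by rw [← h2]; exact h1
      _ ≤ (n : ℝ) ^ (-(1 : ℝ) / 4) / (1 / 2) := div_le_div_of_nonneg_left h4 (by norm_num) h3
      _ = 2 * (n : ℝ) ^ (-(1 : ℝ) / 4) := by ring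
  have hrat : w (M + 2) / w M ≤
      μ ^ 2 * (1 + 2 * K * (n : ℝ) ^ (-(1 : ℝ) / 4)) := by
    calc w (M + 2) / w M
        ≤ μ ^ 2 * (1 + K * (M : ℝ) ^ (-(1 : ℝ) / 4)) := hU M hMN
      _ ≤ μ ^ 2 * (1 + K * (2 * (n : ℝ) ^ (-(1 : ℝ) / 4))) := by gcongr
      _ = μ ^ 2 * (1 + 2 * K * (n : ℝ) ^ (-(1 : ℝ) / 4)) := by ring
  have hb2 : w (M + 2) ≤
      μ ^ 2 * (1 + 2 * K * (n : ℝ) ^ (-(1 : ℝ) / 4)) * w M := by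
    rwa [div_le_iff₀ hbM] at hrat
  unfold normCount
  rw [div_le_iff₀ (pow_pos hμ _), pow_add, show (1 + 2 * K * (n : ℝ) ^ (-(1 : ℝ) / 4)) *
    (w M / μ ^ M) * (μ ^ M * μ ^ 2) =
    μ ^ 2 * (1 + 2 * K * (n : ℝ) ^ (-(1 : ℝ) / 4)) * w M by
      field_simp]
  exact hb2

/-- Elementary: for `y ≥ 2`, `4y + 2 ≤ y^8`. [folklore] -/
private theorem four_mul_add_two_le_pow_eight {y : ℝ} (hy : 2 ≤ y) : 4 * y + 2 ≤ y ^ 8 := by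
  have h7 : (2 : ℝ) ^ 7 ≤ y ^ 7 := pow_le_pow_left₀ (by norm_num) hy 7
  have hy0 : 0 ≤ y := by linarith
  have : y ^ 8 = y * y ^ 7 := by ring
  nlinarith

/-- **Eventual form with the constant read off.** From the upper two-step rate with constant
`K ≥ 0` beyond `N₀`: there is `N₂` with
`|b_n/b_{n−1} − μ| ≤ μ(128μ + 64μK + 64K)/log n` for all `n ≥ N₂`
(`T = ⌊n^{1/8}⌋`, `η = 2K n^{-1/4}`, dropped mass `≤ 32/log n`, `Tη ≤ 16K/log n`, `E_o ≥ 1/μ`).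
[cite: MadrasSlade1993, Theorem 7.3.4 (d) (proof, eq. (7.3.14), quantitative form); LawlerSchrammWerner2004SAW, Appendix (A.3)] -/
theorem ratio_rate_eventually_of (d : ℕ) {w : ℕ → ℝ} (hw : ∀ n, 0 < w n)
    (hren : ∀ n, 1 ≤ n → ∑ k ∈ Icc 1 n, (irreducibleBridgeCount (d + 2) k : ℝ) * w (n - k) ≤ w n) {K : ℝ} {N₀ : ℕ} (hK : 0 ≤ K)
    (hU : ∀ N : ℕ, N₀ ≤ N → w (N + 2) / w N ≤ connectiveConstant (d + 2) ^ 2 * (1 + K * (N : ℝ) ^ (-(1 : ℝ) / 4))) :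
    ∃ N₂ : ℕ, ∀ n : ℕ, N₂ ≤ n →
      |w n / w (n - 1) - connectiveConstant (d + 2)| ≤
        connectiveConstant (d + 2) * (128 * connectiveConstant (d + 2) +
          64 * connectiveConstant (d + 2) * K + 64 * K) / Real.log n := by
  set μ := connectiveConstant (d + 2) with hμdef
  have hμ : 0 < μ := connectiveConstant_pos (d + 2)
  have hμ1 : 1 ≤ μ := one_le_connectiveConstant (d + 2)
  -- thresholds: `n^{1/8} ≥ Y₀ := max 2 (max (4K) (μ^2))` and `n ≥ 2 N₀`
  set Y₀ : ℝ := max 2 (max (4 * K) (μ ^ 2)) with hY₀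
  have hev1 : ∀ᶠ n : ℕ in atTop, Y₀ ≤ (n : ℝ) ^ ((1 : ℝ) / 8) :=
    ((tendsto_rpow_atTop (by norm_num : (0 : ℝ) < 1 / 8)).comp tendsto_natCast_atTop_atTop).eventually_ge_atTop Y₀
  have hev2 : ∀ᶠ n : ℕ in atTop, 2 * N₀ ≤ n := eventually_ge_atTop _
  obtain ⟨N₂, hN₂⟩ := eventually_atTop.1 (hev1.and hev2)
  refine ⟨N₂, fun n hn => ?_⟩
  obtain ⟨hy, hN0⟩ := hN₂ n hn
  set y : ℝ := (n : ℝ) ^ ((1 : ℝ) / 8) with hydef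
  have hy2 : 2 ≤ y := le_trans (le_max_left _ _) hy
  have hyK : 4 * K ≤ y := le_trans (le_trans (le_max_left _ _) (le_max_right _ _)) hy
  have hyμ : μ ^ 2 ≤ y := le_trans (le_trans (le_max_right _ _) (le_max_right _ _)) hy
  have hy0 : 0 < y := by linarith
  have hn0' : (0 : ℝ) ≤ n := Nat.cast_nonneg n
  have hn_eq : (n : ℝ) = y ^ 8 := by
    rw [hydef, show ((1 : ℝ) / 8) = ((8 : ℕ) : ℝ)⁻¹ by norm_num, Real.rpow_inv_natCast_pow hn0' (by norm_num)]
  have hn256 : (256 : ℝ) ≤ n := by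
    rw [hn_eq]; nlinarith [pow_le_pow_left₀ (by norm_num : (0:ℝ) ≤ 2) hy2 8]
  have hn2 : 2 ≤ n := by exact_mod_cast (show (2 : ℝ) ≤ n by linarith)
  have hn0 : (0 : ℝ) < n := by exact_mod_cast (show 0 < n by omega)
  have hlogn : 0 < Real.log n := Real.log_pos (by exact_mod_cast (show 1 < n by omega))
  -- `T = ⌊y⌋`
  set T : ℕ := ⌊y⌋₊ with hTdef
  have hT1 : 1 ≤ T := (Nat.one_le_floor_iff y).2 (by linarith)
  have hTy : (T : ℝ) ≤ y := Nat.floor_le hy0.le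
  have hyT : y < T + 1 := Nat.lt_floor_add_one y
  have hwinR : (2 * (2 * T + 1) : ℝ) ≤ n := by
    rw [hn_eq]; have := four_mul_add_two_le_pow_eight hy2; linarith
  have hwin : 2 * (2 * T + 1) ≤ n := by exact_mod_cast hwinR
  have hT : 2 * T + 1 ≤ n := by omega
  -- `η = 2K n^{-1/4} = 2K / y^2`
  set η : ℝ := 2 * K * (n : ℝ) ^ (-(1 : ℝ) / 4) with hηdef
  have hnq : (n : ℝ) ^ (-(1 : ℝ) / 4) = (y ^ 2)⁻¹ := by
    rw [show (-(1 : ℝ) / 4) = ((1 : ℝ) / 8) * (-2) by norm_num, Real.rpow_mul hn0', ← hydef,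
      Real.rpow_neg hy0.le, Real.rpow_two]
  have hη0 : 0 ≤ η := by rw [hηdef]; exact mul_nonneg (by linarith) (Real.rpow_nonneg hn0' _)
  have hηy : η = 2 * K / y ^ 2 := by rw [hηdef, hnq, div_eq_mul_inv]
  have hTη' : (T : ℝ) * η ≤ 2 * K / y := by
    rw [hηy]
    have : (T : ℝ) * (2 * K / y ^ 2) ≤ y * (2 * K / y ^ 2) :=
      mul_le_mul_of_nonneg_right hTy (by positivity)
    calc (T : ℝ) * (2 * K / y ^ 2) ≤ y * (2 * K / y ^ 2) := this
      _ = 2 * K / y := by field_simp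
  have hTη : (T : ℝ) * η ≤ 1 / 2 := by
    refine hTη'.trans ?_
    rw [div_le_iff₀ hy0]; linarith
  -- the sandwich
  have hS := sandwich_packaged_of_le (normCount d w) (renewalP (d + 2)) n T η hT1 hT hη0 hTη
    (fun k => (normCount_pos d hw k).le) (renewalP_nonneg (d + 2)) (normCount_pos d hw n) (normCount_pos d hw (n - 1))
    (lt_of_lt_of_le (inv_pos.2 hμ) (inv_le_renewalP_one (d + 2))) (sum_renewalP_le_one (d + 2) _)
    (normCount_renewal_le d hren) (hup_of_upperRate d hw hK hU hwin hN0)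
  -- `E_o ≥ 1/μ`
  have hEo : μ⁻¹ ≤ ∑ t ∈ range T, renewalP (d + 2) (2 * t + 1) := by
    have h1 : renewalP (d + 2) (2 * 0 + 1) ≤ ∑ t ∈ range T, renewalP (d + 2) (2 * t + 1) :=
      Finset.single_le_sum (f := fun t => renewalP (d + 2) (2 * t + 1)) (fun t _ => renewalP_nonneg (d + 2) _)
        (Finset.mem_range.2 (by omega))
    exact le_trans (inv_le_renewalP_one (d + 2)) (by simpa using h1)
  have hEo_pos : 0 < ∑ t ∈ range T, renewalP (d + 2) (2 * t + 1) := lt_of_lt_of_le (inv_pos.2 hμ) hEo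
  -- dropped mass `ε ≤ 32 / log n`
  have h2T1 : 1 ≤ 2 * T := by omega
  have hy2T : y ≤ (2 * T : ℕ) := by push_cast; linarith
  have hμ2T : μ ≤ (2 * T : ℕ) := by nlinarith
  have hε1 := kestenTail_le_inv_log (d + 2) h2T1 hμ2T
  have hL : Real.log n / 16 ≤ Real.log (((2 * T : ℕ) : ℝ) / μ) := by
    have h1 : Real.log (y / μ) ≤ Real.log (((2 * T : ℕ) : ℝ) / μ) :=
      Real.log_le_log (by positivity) (div_le_div_of_nonneg_right hy2T hμ.le)
    have h2 : Real.log (y / μ) = Real.log y - Real.log μ := Real.log_div hy0.ne' hμ.ne'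
    have h3 : Real.log y = (1 : ℝ) / 8 * Real.log n := by rw [hydef, Real.log_rpow hn0]
    have h4 : 2 * Real.log μ ≤ Real.log y := by
      have : Real.log (μ ^ 2) = 2 * Real.log μ := by
        rw [Real.log_pow]; norm_num
      rw [← this]; exact Real.log_le_log (by positivity) hyμ
    linarith
  have hLpos : 0 < Real.log (((2 * T : ℕ) : ℝ) / μ) := lt_of_lt_of_le (by linarith) hL
  have hε : 1 - ∑ k ∈ Icc 1 (2 * T), renewalP (d + 2) k ≤ 32 / Real.log n := by
    refine hε1.trans ?_
    calc 1 / (1 + Real.log (((2 * T : ℕ) : ℝ) / μ) / 2)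
        ≤ 1 / (Real.log (((2 * T : ℕ) : ℝ) / μ) / 2) :=
          one_div_le_one_div_of_le (by linarith) (by linarith)
      _ ≤ 1 / (Real.log n / 32) := one_div_le_one_div_of_le (by positivity) (by linarith)
      _ = 32 / Real.log n := by rw [one_div_div]
  -- `Tη ≤ 16K / log n` via `log n ≤ 8 y`
  have hlog8 : Real.log n ≤ 8 * y := by
    have := Real.log_le_rpow_div hn0' (by norm_num : (0 : ℝ) < 1 / 8)
    rw [← hydef] at this; linarith
  have hTηlog : (T : ℝ) * η ≤ 16 * K / Real.log n := by
    refine hTη'.trans ?_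
    rw [div_le_div_iff₀ hy0 hlogn]
    nlinarith
  -- assemble `|a_n/a_{n-1} − 1| ≤ K₁ / log n`
  have hfrac : ((1 - ∑ k ∈ Icc 1 (2 * T), renewalP (d + 2) k) + T * η) / (∑ t ∈ range T, renewalP (d + 2) (2 * t + 1)) ≤
      μ * ((32 + 16 * K) / Real.log n) := by
    have hnum0 : 0 ≤ (1 - ∑ k ∈ Icc 1 (2 * T), renewalP (d + 2) k) + T * η := by
      have := sum_renewalP_le_one (d + 2) (Icc 1 (2 * T))
      have := mul_nonneg (Nat.cast_nonneg T) hη0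
      linarith
    calc ((1 - ∑ k ∈ Icc 1 (2 * T), renewalP (d + 2) k) + T * η) / (∑ t ∈ range T, renewalP (d + 2) (2 * t + 1))
        ≤ ((1 - ∑ k ∈ Icc 1 (2 * T), renewalP (d + 2) k) + T * η) / μ⁻¹ :=
          div_le_div_of_nonneg_left hnum0 (inv_pos.2 hμ) hEo
      _ = μ * ((1 - ∑ k ∈ Icc 1 (2 * T), renewalP (d + 2) k) + T * η) := by rw [div_inv_eq_mul, mul_comm]
      _ ≤ μ * (32 / Real.log n + 16 * K / Real.log n) := by gcongr
      _ = μ * ((32 + 16 * K) / Real.log n) := by ring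
  have hA : |normCount d w n / normCount d w (n - 1) - 1| ≤
      (128 * μ + 64 * μ * K + 64 * K) / Real.log n := by
    refine hS.trans ?_
    have : 4 * (μ * ((32 + 16 * K) / Real.log n) + 16 * K / Real.log n) =
        (128 * μ + 64 * μ * K + 64 * K) / Real.log n := by
      field_simp; ring
    rw [← this]; gcongr
  -- convert to `b_n / b_{n-1}`
  have hconv : w n / w (n - 1) - μ =
      μ * (normCount d w n / normCount d w (n - 1) - 1) := by
    have hb1 : (0 : ℝ) < w (n - 1) := hw (n - 1)
    obtain ⟨n', hn'⟩ : ∃ n', n = n' + 1 := ⟨n - 1, by omega⟩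
    subst hn'
    have hb0 : (0 : ℝ) < w n' := hw n'
    have haB : normCount d w (n' + 1) / normCount d w (n' + 1 - 1) =
        w (n' + 1) / (μ * w n') := by
      simp only [normCount, Nat.add_sub_cancel]
      rw [← hμdef, pow_succ]
      field_simp
    rw [haB, Nat.add_sub_cancel]
    field_simp
  rw [hconv, abs_mul, abs_of_pos hμ, mul_div_assoc]
  exact mul_le_mul_of_nonneg_left hA hμ.le

/-- **The one-step rate from the two inputs**: an upper two-step rate `b_{N+2}/b_N ≤ μ²(1 + K' N^{-1/4})`
(`N ≥ N₀`) implies a RATE for Madras–Slade Thm 7.3.4(d): `∃ K, ∀ N ≥ 2, |b_{N+1}/b_N − μ| ≤ K/log N`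
(every `d ≥ 2`; the finitely many `N` below the threshold are absorbed into `K`).
[cite: MadrasSlade1993, Theorem 7.3.4 (d) (quantitative form); LawlerSchrammWerner2004SAW, Appendix (A.3)] -/
theorem ratio_rate_log_of (d : ℕ) {w : ℕ → ℝ} (hw : ∀ n, 0 < w n)
    (hren : ∀ n, 1 ≤ n → ∑ k ∈ Icc 1 n, (irreducibleBridgeCount (d + 2) k : ℝ) * w (n - k) ≤ w n)
    (hU : ∃ K' : ℝ, ∃ N₀ : ℕ, ∀ N : ℕ, N₀ ≤ N → w (N + 2) / w N ≤
      connectiveConstant (d + 2) ^ 2 * (1 + K' * (N : ℝ) ^ (-(1 : ℝ) / 4))) :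
    ∃ K : ℝ, ∀ N : ℕ, 2 ≤ N →
      |w (N + 1) / w N - connectiveConstant (d + 2)| ≤
        K / Real.log N := by
  obtain ⟨K', N₀, hU⟩ := hU
  set μ := connectiveConstant (d + 2) with hμdef
  have hμ : 0 < μ := connectiveConstant_pos (d + 2)
  have hU' : ∀ N : ℕ, N₀ ≤ N → w (N + 2) / w N ≤ μ ^ 2 * (1 + max K' 0 * (N : ℝ) ^ (-(1 : ℝ) / 4)) := by
    intro N hN
    refine (hU N hN).trans ?_
    have hr : 0 ≤ (N : ℝ) ^ (-(1 : ℝ) / 4) := Real.rpow_nonneg (Nat.cast_nonneg N) _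
    have hμ2 : 0 ≤ μ ^ 2 := sq_nonneg _
    have : K' * (N : ℝ) ^ (-(1 : ℝ) / 4) ≤ max K' 0 * (N : ℝ) ^ (-(1 : ℝ) / 4) :=
      mul_le_mul_of_nonneg_right (le_max_left _ _) hr
    nlinarith
  have hK0 : 0 ≤ max K' 0 := le_max_right _ _
  obtain ⟨N₂, hN₂⟩ := ratio_rate_eventually_of d hw hren hK0 hU'
  set K₁ : ℝ := μ * (128 * μ + 64 * μ * max K' 0 + 64 * max K' 0) with hK₁
  have hK₁0 : 0 ≤ K₁ := by positivity
  -- the finite patch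
  set g : ℕ → ℝ := fun N =>
    |w (N + 1) / w N - μ| * Real.log N with hg
  have hg0 : ∀ N, 0 ≤ g N := fun N =>
    mul_nonneg (abs_nonneg _) (Real.log_natCast_nonneg N)
  set S : ℝ := ∑ N ∈ range N₂, g N with hS
  have hS0 : 0 ≤ S := Finset.sum_nonneg fun N _ => hg0 N
  refine ⟨K₁ + S, fun N hN => ?_⟩
  have hlogN : 0 < Real.log N := Real.log_pos (by exact_mod_cast (show 1 < N by omega))
  by_cases hcase : N₂ ≤ N + 1
  · -- asymptotic regime
    have h := hN₂ (N + 1) hcase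
    rw [Nat.add_sub_cancel] at h
    have hlog_le : Real.log N ≤ Real.log ((N + 1 : ℕ) : ℝ) :=
      Real.log_le_log (by exact_mod_cast (show 0 < N by omega)) (by exact_mod_cast (show N ≤ N + 1 by omega))
    calc |w (N + 1) / w N - μ|
        ≤ K₁ / Real.log ((N + 1 : ℕ) : ℝ) := h
      _ ≤ K₁ / Real.log N := div_le_div_of_nonneg_left hK₁0 hlogN hlog_le
      _ ≤ (K₁ + S) / Real.log N := by gcongr; linarith
  · -- finite regime: `N < N₂`
    have hmem : N ∈ range N₂ := Finset.mem_range.2 (by omega)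
    have hle : g N ≤ S := Finset.single_le_sum (fun M _ => hg0 M) hmem
    have h1 : |w (N + 1) / w N - μ| ≤ S / Real.log N := by
      rw [le_div_iff₀ hlogN]; exact hle
    calc |w (N + 1) / w N - μ|
        ≤ S / Real.log N := h1
      _ ≤ (K₁ + S) / Real.log N := by gcongr; linarith

/-! ### The sharp-constant form -/

/-- Per-index core bound with a free window length `T`: for `T ≥ 1`, `2(2T+1) ≤ n`, `2N₀ ≤ n`, `μ ≤ 2T`,
`η = 2K n^{-1/4}` with `Tη ≤ 1/2`:
`|b_n/b_{n−1} − μ| ≤ μ · (1/(1+½log(2T/μ)) + Tη)/((1−Tη)·E_o^{(T)})`, `E_o^{(T)} = Σ_{t<T} λ_{2t+1}μ^{-(2t+1)}`.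
[cite: MadrasSlade1993, Theorem 7.3.4 (d) (proof, eq. (7.3.14), quantitative form)] -/
theorem ratio_bound_core_of (d : ℕ) {w : ℕ → ℝ} (hw : ∀ n, 0 < w n)
    (hren : ∀ n, 1 ≤ n → ∑ k ∈ Icc 1 n, (irreducibleBridgeCount (d + 2) k : ℝ) * w (n - k) ≤ w n) {K : ℝ} {N₀ : ℕ} (hK : 0 ≤ K) (hU : ∀ N : ℕ, N₀ ≤ N → w (N + 2) / w N ≤ connectiveConstant (d + 2) ^ 2 * (1 + K * (N : ℝ) ^ (-(1 : ℝ) / 4)))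
    {n T : ℕ} (hT1 : 1 ≤ T) (hwin : 2 * (2 * T + 1) ≤ n) (hN₀ : 2 * N₀ ≤ n)
    (hμT : connectiveConstant (d + 2) ≤ ((2 * T : ℕ) : ℝ))
    (hTη : (T : ℝ) * (2 * K * (n : ℝ) ^ (-(1 : ℝ) / 4)) ≤ 1 / 2) :
    |w n / w (n - 1) - connectiveConstant (d + 2)| ≤
      connectiveConstant (d + 2) *
        (((1 / (1 + Real.log (((2 * T : ℕ) : ℝ) / connectiveConstant (d + 2)) / 2)) +
            T * (2 * K * (n : ℝ) ^ (-(1 : ℝ) / 4))) /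
          ((1 - T * (2 * K * (n : ℝ) ^ (-(1 : ℝ) / 4))) * ∑ t ∈ range T, renewalP (d + 2) (2 * t + 1))) := by
  set μ := connectiveConstant (d + 2) with hμdef
  have hμ : 0 < μ := connectiveConstant_pos (d + 2)
  set η : ℝ := 2 * K * (n : ℝ) ^ (-(1 : ℝ) / 4) with hηdef
  have hn0' : (0 : ℝ) ≤ n := Nat.cast_nonneg n
  have hη0 : 0 ≤ η := by rw [hηdef]; exact mul_nonneg (by linarith) (Real.rpow_nonneg hn0' _)
  have hT : 2 * T + 1 ≤ n := by omega
  have hS := _root_.Literature.Probability.Process.Renewal.ratio_sandwich_sharp_of_le (normCount d w) (renewalP (d + 2)) n T η hT1 hT hη0 hTη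
    (fun k => (normCount_pos d hw k).le) (renewalP_nonneg (d + 2)) (normCount_pos d hw n) (normCount_pos d hw (n - 1))
    (lt_of_lt_of_le (inv_pos.2 hμ) (inv_le_renewalP_one (d + 2))) (sum_renewalP_le_one (d + 2) _)
    (normCount_renewal_le d hren) (hup_of_upperRate d hw hK hU hwin hN₀)
  set Eo := ∑ t ∈ range T, renewalP (d + 2) (2 * t + 1) with hEo
  have hEo_pos : 0 < Eo := by
    have h1 : renewalP (d + 2) (2 * 0 + 1) ≤ Eo :=
      Finset.single_le_sum (f := fun t => renewalP (d + 2) (2 * t + 1)) (fun t _ => renewalP_nonneg (d + 2) _)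
        (Finset.mem_range.2 (by omega))
    have h2 := lt_of_lt_of_le (inv_pos.2 hμ) (inv_le_renewalP_one (d + 2))
    exact lt_of_lt_of_le h2 (by simpa using h1)
  have hθ : 0 < 1 - (T : ℝ) * η := by linarith
  have hden : 0 < (1 - (T : ℝ) * η) * Eo := mul_pos hθ hEo_pos
  -- replace the dropped mass by the explicit Kesten tail
  have h2T1 : 1 ≤ 2 * T := by omega
  have hε := kestenTail_le_inv_log (d + 2) h2T1 hμT
  have hS' : |normCount d w n / normCount d w (n - 1) - 1| ≤
      ((1 / (1 + Real.log (((2 * T : ℕ) : ℝ) / μ) / 2)) + T * η) / ((1 - T * η) * Eo) := by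
    refine hS.trans (div_le_div_of_nonneg_right ?_ hden.le)
    have : 1 - ∑ k ∈ Icc 1 (2 * T), renewalP (d + 2) k ≤ 1 / (1 + Real.log (((2 * T : ℕ) : ℝ) / μ) / 2) := hε
    linarith
  -- convert to `b_n / b_{n-1}`
  have hconv : w n / w (n - 1) - μ =
      μ * (normCount d w n / normCount d w (n - 1) - 1) := by
    obtain ⟨n', hn'⟩ : ∃ n', n = n' + 1 := ⟨n - 1, by omega⟩
    subst hn'
    have hb0 : (0 : ℝ) < w n' := hw n'
    have haB : normCount d w (n' + 1) / normCount d w (n' + 1 - 1) =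
        w (n' + 1) / (μ * w n') := by
      simp only [normCount, Nat.add_sub_cancel]
      rw [← hμdef, pow_succ]
      field_simp
    rw [haB, Nat.add_sub_cancel]
    field_simp
  rw [hconv, abs_mul, abs_of_pos hμ]
  exact mul_le_mul_of_nonneg_left hS' hμ.le

/-- Elementary: for `z ≥ 2`, `4z + 2 ≤ z^4`. [folklore] -/
private theorem four_mul_add_two_le_pow_four {z : ℝ} (hz : 2 ≤ z) : 4 * z + 2 ≤ z ^ 4 := by
  have h3 : (2 : ℝ) ^ 3 ≤ z ^ 3 := pow_le_pow_left₀ (by norm_num) hz 3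
  have : z ^ 4 = z * z ^ 3 := by ring
  nlinarith

/-- **Sharp-constant form**: for every `α ∈ (0, 1/4)`,
`δ > 0` and `T₀ ≥ 1`, eventually in `N`,
`|b_{N+1}/b_N − μ| ≤ (2μ/(α E) + δ)/log N`, `E = Σ_{t<T₀} λ_{2t+1} μ^{-(2t+1)}` (any odd partial sum
of Kesten's masses — the FINITE-DATA constant; `λ₁ = 1, λ₃ = 2` on `ℤ²` give `E ≥ 1/μ + 2/μ³`). The
leading constant is free of the two-step-rate constant, which only enters the threshold.
[cite: MadrasSlade1993, Theorem 7.3.4 (d) (proof, eq. (7.3.14): E_o, E_e); LawlerSchrammWerner2004SAW, Appendix (A.3)] -/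
theorem ratio_rate_limsup_of (d : ℕ) {w : ℕ → ℝ} (hw : ∀ n, 0 < w n)
    (hren : ∀ n, 1 ≤ n → ∑ k ∈ Icc 1 n, (irreducibleBridgeCount (d + 2) k : ℝ) * w (n - k) ≤ w n)
    (hU0 : ∃ K : ℝ, 0 ≤ K ∧ ∃ N₀ : ℕ, ∀ N : ℕ, N₀ ≤ N → w (N + 2) / w N ≤
      connectiveConstant (d + 2) ^ 2 * (1 + K * (N : ℝ) ^ (-(1 : ℝ) / 4))) (T₀ : ℕ) (hT₀ : 1 ≤ T₀) {α : ℝ} (hα0 : 0 < α) (hα : α < 1 / 4)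
    {δ : ℝ} (hδ : 0 < δ) :
    ∀ᶠ N : ℕ in atTop,
      |w (N + 1) / w N - connectiveConstant (d + 2)| ≤
        (2 * connectiveConstant (d + 2) /
            (α * ∑ t ∈ range T₀, (irreducibleBridgeCount (d + 2) (2 * t + 1) : ℝ) /
              connectiveConstant (d + 2) ^ (2 * t + 1)) + δ) / Real.log N := by
  obtain ⟨K, hK, N₀, hU⟩ := hU0
  set μ := connectiveConstant (d + 2) with hμdef
  have hμ : 0 < μ := connectiveConstant_pos (d + 2)
  have hμ1 : 1 ≤ μ := one_le_connectiveConstant (d + 2)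
  -- the finite-data constant `E = Σ_{t<T₀} p_{2t+1} > 0`
  set E := ∑ t ∈ range T₀, renewalP (d + 2) (2 * t + 1) with hE
  have hEeq : ∑ t ∈ range T₀, (irreducibleBridgeCount (d + 2) (2 * t + 1) : ℝ) / μ ^ (2 * t + 1) = E := by
    rw [hE]; rfl
  have hE_pos : 0 < E := by
    have h1 : renewalP (d + 2) (2 * 0 + 1) ≤ E :=
      Finset.single_le_sum (f := fun t => renewalP (d + 2) (2 * t + 1)) (fun t _ => renewalP_nonneg (d + 2) _)
        (Finset.mem_range.2 (by omega))
    exact lt_of_lt_of_le (lt_of_lt_of_le (inv_pos.2 hμ) (inv_le_renewalP_one (d + 2))) (by simpa using h1)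
  set C : ℝ := 2 * μ / (α * E) with hC
  have hr : 0 < 1 / 4 - α := by linarith
  -- the comparison functions
  set L : ℕ → ℝ := fun n => Real.log n with hL
  set k : ℕ → ℝ := fun n => 2 * K * (n : ℝ) ^ (-(1 / 4 - α)) with hk
  set g : ℕ → ℝ := fun n => 2 * L n / (2 + α * L n - 2 * Real.log μ) with hg
  set h : ℕ → ℝ := fun n => 2 * K * (Real.log n / (n : ℝ) ^ (1 / 4 - α)) with hh
  set R : ℕ → ℝ := fun n => μ * (g n + h n) / ((1 - k n) * E) with hR
  -- limits
  have hLlim : Tendsto L atTop atTop := Real.tendsto_log_atTop.comp tendsto_natCast_atTop_atTop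
  have hklim : Tendsto k atTop (𝓝 0) := by
    have := ((tendsto_rpow_neg_atTop hr).comp tendsto_natCast_atTop_atTop).const_mul (2 * K)
    simpa [hk] using this
  have hhlim : Tendsto h atTop (𝓝 0) := by
    have h1 := ((isLittleO_log_rpow_atTop hr).tendsto_div_nhds_zero).comp tendsto_natCast_atTop_atTop
    have := h1.const_mul (2 * K)
    simpa [hh] using this
  have hglim : Tendsto g atTop (𝓝 (2 / α)) := by
    have h1 : Tendsto (fun n => (2 - 2 * Real.log μ) / L n) atTop (𝓝 0) :=
      tendsto_const_nhds.div_atTop hLlim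
    have h2 : Tendsto (fun n => 2 / (α + (2 - 2 * Real.log μ) / L n)) atTop (𝓝 (2 / α)) := by
      have : Tendsto (fun n => α + (2 - 2 * Real.log μ) / L n) atTop (𝓝 (α + 0)) :=
        tendsto_const_nhds.add h1
      rw [add_zero] at this
      exact tendsto_const_nhds.div this hα0.ne'
    refine h2.congr' ?_
    have hev1 : ∀ᶠ n : ℕ in atTop, 1 < L n := hLlim.eventually_gt_atTop 1
    have hev2 : ∀ᶠ n : ℕ in atTop, 2 * Real.log μ / α < L n := hLlim.eventually_gt_atTop _
    filter_upwards [hev1, hev2] with n hn hn2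
    have hLn : L n ≠ 0 := by linarith
    have hn2' : 2 * Real.log μ < α * L n := by rw [div_lt_iff₀ hα0] at hn2; linarith
    have hD : 2 + α * L n - 2 * Real.log μ ≠ 0 := by linarith
    rw [hg]
    simp only
    rw [show α + (2 - 2 * Real.log μ) / L n = (2 + α * L n - 2 * Real.log μ) / L n by
      field_simp; ring, div_div_eq_mul_div]
  have hRlim : Tendsto R atTop (𝓝 C) := by
    have h1 : Tendsto (fun n => μ * (g n + h n)) atTop (𝓝 (μ * (2 / α + 0))) :=
      (hglim.add hhlim).const_mul μ
    have h2 : Tendsto (fun n => (1 - k n) * E) atTop (𝓝 ((1 - 0) * E)) :=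
      (tendsto_const_nhds.sub hklim).mul_const E
    have h3 := h1.div h2 (by simpa using hE_pos.ne')
    have hCe : μ * (2 / α + 0) / ((1 - 0) * E) = C := by
      rw [hC, add_zero, sub_zero, one_mul]; field_simp
    rw [hCe] at h3
    exact h3
  -- eventual side conditions (in the shifted index `n = N + 1`)
  have F1 : ∀ᶠ n : ℕ in atTop, max 2 (max μ (T₀ : ℝ)) ≤ (n : ℝ) ^ α :=
    ((tendsto_rpow_atTop hα0).comp tendsto_natCast_atTop_atTop).eventually_ge_atTop _
  have F2 : ∀ᶠ n : ℕ in atTop, (2 : ℝ) ≤ (n : ℝ) ^ ((1 : ℝ) / 4) :=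
    ((tendsto_rpow_atTop (by norm_num : (0 : ℝ) < 1 / 4)).comp tendsto_natCast_atTop_atTop).eventually_ge_atTop _
  have F3 : ∀ᶠ n : ℕ in atTop, 2 * N₀ ≤ n := eventually_ge_atTop _
  have F4 : ∀ᶠ n : ℕ in atTop, k n < 1 / 2 := (tendsto_order.1 hklim).2 _ (by norm_num)
  have F5 : ∀ᶠ n : ℕ in atTop, 2 * Real.log μ < α * L n := by
    have := hLlim.eventually_gt_atTop (2 * Real.log μ / α)
    filter_upwards [this] with n hn
    rw [div_lt_iff₀ hα0] at hn; linarith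
  have F6 : ∀ᶠ n : ℕ in atTop, R n < C + δ := (tendsto_order.1 hRlim).2 _ (by linarith)
  have F7 : ∀ᶠ n : ℕ in atTop, 2 ≤ n := eventually_ge_atTop 2
  have hall : ∀ᶠ n : ℕ in atTop,
      |w n / w (n - 1) - μ| ≤ (C + δ) / Real.log n := by
    filter_upwards [F1, F2, F3, F4, F5, F6, F7] with n hy hz hN0 hkn hLμ hRn hn2
    have hn0 : (0 : ℝ) < n := by exact_mod_cast (show 0 < n by omega)
    have hn0' : (0 : ℝ) ≤ n := hn0.le
    have hlogn : 0 < Real.log n := Real.log_pos (by exact_mod_cast (show 1 < n by omega))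
    have hlogμ : 0 ≤ Real.log μ := Real.log_nonneg hμ1
    have hLμ' : 2 * Real.log μ < α * Real.log n := hLμ
    set y : ℝ := (n : ℝ) ^ α with hydef
    set z : ℝ := (n : ℝ) ^ ((1 : ℝ) / 4) with hzdef
    have hy2 : 2 ≤ y := le_trans (le_max_left _ _) hy
    have hyμ : μ ≤ y := le_trans (le_trans (le_max_left _ _) (le_max_right _ _)) hy
    have hyT₀ : (T₀ : ℝ) ≤ y := le_trans (le_trans (le_max_right _ _) (le_max_right _ _)) hy
    have hy0 : 0 < y := by linarith
    have hyz : y ≤ z := Real.rpow_le_rpow_of_exponent_le (by exact_mod_cast (show 1 ≤ n by omega)) hα.le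
    have hn_eq : (n : ℝ) = z ^ 4 := by
      rw [hzdef, show ((1 : ℝ) / 4) = ((4 : ℕ) : ℝ)⁻¹ by norm_num, Real.rpow_inv_natCast_pow hn0' (by norm_num)]
    -- `T = ⌊y⌋`
    set T : ℕ := ⌊y⌋₊ with hTdef
    have hT1 : 1 ≤ T := (Nat.one_le_floor_iff y).2 (by linarith)
    have hTy : (T : ℝ) ≤ y := Nat.floor_le hy0.le
    have hyT : y < T + 1 := Nat.lt_floor_add_one y
    have hTT₀ : T₀ ≤ T := Nat.le_floor hyT₀
    have hwinR : (2 * (2 * T + 1) : ℝ) ≤ n := by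
      rw [hn_eq]; have := four_mul_add_two_le_pow_four hz; linarith
    have hwin : 2 * (2 * T + 1) ≤ n := by exact_mod_cast hwinR
    have h2Ty : y ≤ ((2 * T : ℕ) : ℝ) := by push_cast; linarith
    have hμT : μ ≤ ((2 * T : ℕ) : ℝ) := hyμ.trans h2Ty
    -- `η = 2K n^{-1/4}`, `Tη ≤ k n < 1/2`
    set η : ℝ := 2 * K * (n : ℝ) ^ (-(1 : ℝ) / 4) with hηdef
    have hη0 : 0 ≤ η := by rw [hηdef]; exact mul_nonneg (by linarith) (Real.rpow_nonneg hn0' _)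
    have hTηk : (T : ℝ) * η ≤ k n := by
      have e1 : y * η = k n := by
        rw [hk, hydef, hηdef]
        simp only
        rw [show -(1 / 4 - α) = α + (-(1 : ℝ) / 4) by ring, Real.rpow_add hn0]
        ring
      calc (T : ℝ) * η ≤ y * η := mul_le_mul_of_nonneg_right hTy hη0
        _ = k n := e1
    have hTη : (T : ℝ) * η ≤ 1 / 2 := by linarith
    -- the core bound
    have hcore := ratio_bound_core_of d hw hren hK hU hT1 hwin hN0 hμT hTη
    -- compare with `R n / log n`
    set Eo := ∑ t ∈ range T, renewalP (d + 2) (2 * t + 1) with hEo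
    have hEoE : E ≤ Eo := by
      rw [hE, hEo]
      exact Finset.sum_le_sum_of_subset_of_nonneg
        (fun t ht => Finset.mem_range.2 (lt_of_lt_of_le (Finset.mem_range.1 ht) hTT₀))
        (fun t _ _ => renewalP_nonneg (d + 2) _)
    have hθ : 0 < 1 - (T : ℝ) * η := by linarith
    set εb : ℝ := 1 / (1 + Real.log (((2 * T : ℕ) : ℝ) / μ) / 2) with hεb
    -- `εb · log n ≤ g n`
    have hLb : α * Real.log n - Real.log μ ≤ Real.log (((2 * T : ℕ) : ℝ) / μ) := by
      have h1 : Real.log (y / μ) ≤ Real.log (((2 * T : ℕ) : ℝ) / μ) :=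
        Real.log_le_log (by positivity) (div_le_div_of_nonneg_right h2Ty hμ.le)
      have h2 : Real.log (y / μ) = Real.log y - Real.log μ := Real.log_div hy0.ne' hμ.ne'
      have h3 : Real.log y = α * Real.log n := by rw [hydef, Real.log_rpow hn0]
      linarith
    have hD0 : 0 < 2 + α * Real.log n - 2 * Real.log μ := by
      have : L n = Real.log n := rfl
      rw [← this]; linarith
    have hεg : εb * Real.log n ≤ g n := by
      have h1 : εb ≤ 2 / (2 + α * Real.log n - 2 * Real.log μ) := by
        rw [hεb]
        rw [div_le_div_iff₀ (by linarith) hD0]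
        linarith
      calc εb * Real.log n ≤ 2 / (2 + α * Real.log n - 2 * Real.log μ) * Real.log n :=
            mul_le_mul_of_nonneg_right h1 hlogn.le
        _ = g n := by rw [hg]; simp only [hL]; ring
    -- `Tη · log n ≤ h n`
    have hTηh : (T : ℝ) * η * Real.log n ≤ h n := by
      have e1 : k n * Real.log n = h n := by
        rw [hk, hh]; simp only
        rw [Real.rpow_neg hn0', div_eq_mul_inv]; ring
      calc (T : ℝ) * η * Real.log n ≤ k n * Real.log n := mul_le_mul_of_nonneg_right hTηk hlogn.le
        _ = h n := e1
    -- assemble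
    have hnum0 : 0 ≤ εb + T * η := by
      have : 0 ≤ εb := by rw [hεb]; exact div_nonneg zero_le_one (by linarith [hLb, hD0])
      have := mul_nonneg (Nat.cast_nonneg T) hη0
      linarith
    have hstep1 : μ * ((εb + T * η) / ((1 - T * η) * Eo)) ≤ μ * ((εb + T * η) / ((1 - k n) * E)) := by
      refine mul_le_mul_of_nonneg_left ?_ hμ.le
      refine div_le_div_of_nonneg_left hnum0 (mul_pos (by linarith) hE_pos) ?_
      exact mul_le_mul (by linarith) hEoE hE_pos.le hθ.le
    have hstep2 : μ * ((εb + T * η) / ((1 - k n) * E)) * Real.log n ≤ R n := by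
      rw [hR]; simp only
      rw [mul_div_assoc, mul_assoc, div_mul_eq_mul_div]
      refine mul_le_mul_of_nonneg_left ?_ hμ.le
      refine div_le_div_of_nonneg_right ?_ (mul_pos (by linarith) hE_pos).le
      have : (εb + T * η) * Real.log n = εb * Real.log n + T * η * Real.log n := by ring
      rw [this]; exact add_le_add hεg hTηh
    have hfin : μ * ((εb + T * η) / ((1 - T * η) * Eo)) ≤ (C + δ) / Real.log n := by
      rw [le_div_iff₀ hlogn]
      calc μ * ((εb + T * η) / ((1 - T * η) * Eo)) * Real.log n
          ≤ μ * ((εb + T * η) / ((1 - k n) * E)) * Real.log n :=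
            mul_le_mul_of_nonneg_right hstep1 hlogn.le
        _ ≤ R n := hstep2
        _ ≤ C + δ := hRn.le
    exact hcore.trans hfin
  -- shift the index: `n = N + 1`, `log N ≤ log (N+1)`
  have hshift := (tendsto_add_atTop_nat 1).eventually hall
  filter_upwards [hshift, eventually_ge_atTop 2] with N hN hN2
  have hlogN : 0 < Real.log N := Real.log_pos (by exact_mod_cast (show 1 < N by omega))
  have hCδ : 0 ≤ C + δ := by
    have : 0 ≤ C := by rw [hC]; positivity
    linarith
  have hlog_le : Real.log N ≤ Real.log ((N + 1 : ℕ) : ℝ) :=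
    Real.log_le_log (by exact_mod_cast (show 0 < N by omega)) (by exact_mod_cast (show N ≤ N + 1 by omega))
  simp only [Nat.add_sub_cancel] at hN
  rw [hEeq, ← hC]
  exact hN.trans (div_le_div_of_nonneg_left hCδ hlogN hlog_le)


/-! ### Half-space walks: LSW (A.3) `h_{N+1}/h_N → μ` WITH A RATE, modulo its two inputs -/

/-- **LSW (A.3) with a rate, modulo the two-step rate**: LSW's renewal inequality `Σ_{1≤j≤n} λ_j h_{n−j} ≤ h_n` is
the tree's `sum_irreducibleBridgeCount_mul_halfSpaceCount_le`; if moreover a two-step rate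
`|h_{N+2}/h_N − μ²| ≤ K N^{-1/4}` (`N ≥ N₀`) holds, then
`∃ K', ∀ N ≥ 2, |h_{N+1}/h_N − μ| ≤ K'/log N` on `ℤ^{d+2}` (LSW prove the limit by lim sup, no rate).
[cite: LawlerSchrammWerner2004SAW, Appendix (A.3); MadrasSlade1993, Theorem 7.3.4 (d)] -/
theorem halfSpaceRatio_rate_log_of (d : ℕ)
    (hTS : ∃ K : ℝ, ∃ N₀ : ℕ, ∀ N : ℕ, N₀ ≤ N →
      |(halfSpaceCount (d + 2) (N + 2) : ℝ) / halfSpaceCount (d + 2) N - connectiveConstant (d + 2) ^ 2| ≤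
        K * (N : ℝ) ^ (-(1 : ℝ) / 4)) :
    ∃ K : ℝ, ∀ N : ℕ, 2 ≤ N →
      |(halfSpaceCount (d + 2) (N + 1) : ℝ) / halfSpaceCount (d + 2) N - connectiveConstant (d + 2)| ≤
        K / Real.log N := by
  have hw : ∀ n, (0 : ℝ) < (halfSpaceCount (d + 2) n : ℝ) := fun n => by
    exact_mod_cast one_le_halfSpaceCount (d := d + 2) n
  have hren : ∀ n, 1 ≤ n → ∑ k ∈ Icc 1 n, (irreducibleBridgeCount (d + 2) k : ℝ) *
      (halfSpaceCount (d + 2) (n - k) : ℝ) ≤ (halfSpaceCount (d + 2) n : ℝ) := fun n _ => by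
    exact_mod_cast sum_irreducibleBridgeCount_mul_halfSpaceCount_le (d := d + 2) n
  obtain ⟨K, N₀, hK⟩ := hTS
  have hμ1 : 1 ≤ connectiveConstant (d + 2) := one_le_connectiveConstant (d + 2)
  have hμ2 : 1 ≤ connectiveConstant (d + 2) ^ 2 := one_le_pow₀ hμ1
  refine ratio_rate_log_of d hw hren ⟨max K 0, N₀, fun N hN => ?_⟩
  have h1 := (abs_le.1 (hK N hN)).2
  have hr : 0 ≤ (N : ℝ) ^ (-(1 : ℝ) / 4) := Real.rpow_nonneg (Nat.cast_nonneg N) _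
  have h2 : K * (N : ℝ) ^ (-(1 : ℝ) / 4) ≤ max K 0 * (N : ℝ) ^ (-(1 : ℝ) / 4) :=
    mul_le_mul_of_nonneg_right (le_max_left _ _) hr
  have h3 : 0 ≤ max K 0 * (N : ℝ) ^ (-(1 : ℝ) / 4) := mul_nonneg (le_max_right _ _) hr
  nlinarith

/-- **LSW (A.3) with the SHARP constant, modulo the two-step rate**: for every `α ∈ (0,1/4)`, `δ > 0`, `T₀ ≥ 1`,
eventually `|h_{N+1}/h_N − μ| ≤ (2μ/(αE) + δ)/log N`, `E = Σ_{t<T₀} λ_{2t+1} μ^{-(2t+1)}` — the same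
finite-data constant as for bridges. [cite: LawlerSchrammWerner2004SAW, Appendix (A.3); MadrasSlade1993, Theorem 7.3.4 (d)] -/
theorem halfSpaceRatio_rate_limsup_of (d : ℕ)
    (hTS : ∃ K : ℝ, ∃ N₀ : ℕ, ∀ N : ℕ, N₀ ≤ N →
      |(halfSpaceCount (d + 2) (N + 2) : ℝ) / halfSpaceCount (d + 2) N - connectiveConstant (d + 2) ^ 2| ≤
        K * (N : ℝ) ^ (-(1 : ℝ) / 4))
    (T₀ : ℕ) (hT₀ : 1 ≤ T₀) {α : ℝ} (hα0 : 0 < α) (hα : α < 1 / 4) {δ : ℝ} (hδ : 0 < δ) :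
    ∀ᶠ N : ℕ in atTop,
      |(halfSpaceCount (d + 2) (N + 1) : ℝ) / halfSpaceCount (d + 2) N - connectiveConstant (d + 2)| ≤
        (2 * connectiveConstant (d + 2) /
            (α * ∑ t ∈ range T₀, (irreducibleBridgeCount (d + 2) (2 * t + 1) : ℝ) /
              connectiveConstant (d + 2) ^ (2 * t + 1)) + δ) / Real.log N := by
  have hw : ∀ n, (0 : ℝ) < (halfSpaceCount (d + 2) n : ℝ) := fun n => by
    exact_mod_cast one_le_halfSpaceCount (d := d + 2) n
  have hren : ∀ n, 1 ≤ n → ∑ k ∈ Icc 1 n, (irreducibleBridgeCount (d + 2) k : ℝ) *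
      (halfSpaceCount (d + 2) (n - k) : ℝ) ≤ (halfSpaceCount (d + 2) n : ℝ) := fun n _ => by
    exact_mod_cast sum_irreducibleBridgeCount_mul_halfSpaceCount_le (d := d + 2) n
  obtain ⟨K, N₀, hK⟩ := hTS
  have hμ1 : 1 ≤ connectiveConstant (d + 2) := one_le_connectiveConstant (d + 2)
  have hμ2 : 1 ≤ connectiveConstant (d + 2) ^ 2 := one_le_pow₀ hμ1
  refine ratio_rate_limsup_of d hw hren ⟨max K 0, le_max_right _ _, N₀, fun N hN => ?_⟩ T₀ hT₀ hα0 hα hδ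
  have h1 := (abs_le.1 (hK N hN)).2
  have hr : 0 ≤ (N : ℝ) ^ (-(1 : ℝ) / 4) := Real.rpow_nonneg (Nat.cast_nonneg N) _
  have h2 : K * (N : ℝ) ^ (-(1 : ℝ) / 4) ≤ max K 0 * (N : ℝ) ^ (-(1 : ℝ) / 4) :=
    mul_le_mul_of_nonneg_right (le_max_left _ _) hr
  have h3 : 0 ≤ max K 0 * (N : ℝ) ^ (-(1 : ℝ) / 4) := mul_nonneg (le_max_right _ _) hr
  nlinarith

end Literature.Probability.RandomPlanarGeometry.SAW.Zd

end
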